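import Summits.RiemannHypothesis.RiemannHypothesis.Theorems.SignConeConeMagnificationStubChebyshev
import Mathlib.Analysis.SpecialFunctions.Integrals.Basic
import Mathlib.MeasureTheory.Integral.IntervalIntegral.FundThmCalculus

/-!
# Stub `stub_fakeMertens` of line `Sketch` for crux `SignCone.ConeMagnification`, part 1: the integrated
discrepancy (item stmt-RiemannHypothesis-16303, route route-RiemannHypothesis-SignCone; HELPER file,
`--supports`, anchored by the auxiliary stub `stub_fakeMertens_integrated`)

Let `φ` be a Weil test supported in `[-a, a]` (`0 < a ≤ 1`), `K = φ ⋆ φ̃ = weilConv φ (weilReflect φ)`,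
`K̂ = weilMellin K`, and let `c : ℕ → ℝ` satisfy the discrepancy bound
`‖S(x) − e^{x/2} K̂(0) − e^{-x/2} K̂(1)‖ ≤ C` for all real `x`, where
`S(x) = Σₙ c(n) n^{-1/2} (K(x + log n) + K(x − log n))` (the output of `stub_fakePNT`).

* `abs_re_discrepancy_le` — for `x ≥ 2a` the terms `K(x + log n)` vanish, the fake sum is a finite sum,
  and the REAL discrepancy `d(x) = Σₙ c(n) n^{-1/2} Re K(x − log n) − e^{x/2} Re K̂(0) − e^{-x/2} Re K̂(1)`
  has `|d(x)| ≤ C` (`|Re z| ≤ ‖z‖`);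
* `integral_term_eq` — the substitution `u = x − log n`:
  `∫_{y'}^{y} e^{-x/2} c(n) n^{-1/2} k(x − log n) dx = (c(n)/n) (∫_{A−log n}^{y−log n} − ∫_{A−log n}^{y'−log n}) e^{-u/2} k(u) du`;
* `stub_fakeMertens_integrated` — integrating `e^{-x/2} d(x)` over `[y', y]` (`2a ≤ y' ≤ y`):
  `|Φ(y) − Φ(y') − (y − y') Re K̂(0)| ≤ 2C e^{-y'/2} + |Re K̂(1)| e^{-y'}` for the WINDOW SUMS
  `Φ(y) = Σ_{n < N} (c(n)/n) ∫_{2a − log n}^{y − log n} e^{-u/2} Re K(u) du` (`N > e^{y+2}`).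

Part 2 (`…StubFakeMertens`) sandwiches the sharp harmonic sums `Σ_{n ≤ x} c(n)/n` between window sums and
lets `a → 0` (Cauchy criterion), proving the registered stub `stub_fakeMertens`.
-/

noncomputable section

-- `Summit.RiemannHypothesis.RiemannHypothesis.…` repeats a namespace component by design (D-0017 layout).
set_option linter.dupNamespace false

open scoped BigOperators ComplexConjugate Topology
open Complex MeasureTheory Set Filter

namespace Summit.RiemannHypothesis.RiemannHypothesis.Theorems.SignConeConeMagnification

open Literature.NumberTheory.LFunctions
open Summit.RiemannHypothesis.RiemannHypothesis.Theorems.SignCone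

/-! ## The real discrepancy past the support and its integral -/

/-- Real form of the discrepancy bound past the support: for `x ≥ 2a` (`tsupport φ ⊆ [-a, a]`, `a ≤ 1`)
the terms `K(x + log n)` vanish, the fake sum is the finite sum over `n ≤ e^{x + 2}`, and
`|Σ_{n < N} c(n) n^{-1/2} Re K(x − log n) − e^{x/2} Re K̂(0) − e^{-x/2} Re K̂(1)| ≤ C`
(`|Re z| ≤ ‖z‖`). [folklore] -/
theorem abs_re_discrepancy_le {c : ℕ → ℝ} {φ : ℝ → ℂ} (hφ : IsWeilTest φ) {a : ℝ} (ha : 0 < a)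
    (ha1 : a ≤ 1) (hsupp : tsupport φ ⊆ Icc (-a) a) {C : ℝ}
    (hC : ∀ x : ℝ,
      ‖(∑' n : ℕ, ((c n : ℝ) : ℂ) / (Real.sqrt n : ℂ) *
            (weilConv φ (weilReflect φ) (x + Real.log n) + weilConv φ (weilReflect φ) (x - Real.log n))) -
          Complex.exp (x / 2) * weilMellin (weilConv φ (weilReflect φ)) 0 -
          Complex.exp (-(x / 2)) * weilMellin (weilConv φ (weilReflect φ)) 1‖ ≤ C)
    {x : ℝ} (hx : 2 * a ≤ x) {N : ℕ} (hN : Real.exp (x + 2) < N) :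
    |(∑ n ∈ Finset.range N, c n / Real.sqrt n * (weilConv φ (weilReflect φ) (x - Real.log n)).re) -
        Real.exp (x / 2) * (weilMellin (weilConv φ (weilReflect φ)) 0).re -
        Real.exp (-(x / 2)) * (weilMellin (weilConv φ (weilReflect φ)) 1).re| ≤ C := by
  set K := weilConv φ (weilReflect φ) with hK
  have hx0 : 0 ≤ x := by linarith
  have hsupp1 : tsupport φ ⊆ Icc (-1) 1 := hsupp.trans (Icc_subset_Icc (by linarith) ha1)
  have hfin : (∑' n : ℕ, ((c n : ℝ) : ℂ) / (Real.sqrt n : ℂ) * (K (x + Real.log n) + K (x - Real.log n))) =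
      ∑ n ∈ Finset.range N, ((c n : ℝ) : ℂ) / (Real.sqrt n : ℂ) *
        (K (x + Real.log n) + K (x - Real.log n)) := by
    refine tsum_eq_sum fun n hn => ?_
    rw [Finset.mem_range, not_lt] at hn
    exact fakeTerm_translate_eq_zero hφ hsupp1 c hx0 (hN.trans_le (by exact_mod_cast hn))
  have hplus : ∀ n : ℕ, (K (x + Real.log n)).re = 0 := fun n => by
    have h0 := Real.log_natCast_nonneg n
    rw [hK, weilConv_weilReflect_eq_zero_of_le_abs hφ hsupp, Complex.zero_re]
    rw [abs_of_nonneg (by linarith)]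
    linarith
  have hre : (∑ n ∈ Finset.range N, ((c n : ℝ) : ℂ) / (Real.sqrt n : ℂ) *
      (K (x + Real.log n) + K (x - Real.log n))).re =
      ∑ n ∈ Finset.range N, c n / Real.sqrt n * (K (x - Real.log n)).re := by
    rw [Complex.re_sum]
    refine Finset.sum_congr rfl fun n _ => ?_
    rw [re_fakeTerm_translate, hplus, zero_add]
  have hexp1 : Complex.exp ((x : ℂ) / 2) = ((Real.exp (x / 2) : ℝ) : ℂ) := by
    rw [Complex.ofReal_exp]
    push_cast
    ring_nf
  have hexp2 : Complex.exp (-((x : ℂ) / 2)) = ((Real.exp (-(x / 2)) : ℝ) : ℂ) := by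
    rw [Complex.ofReal_exp]
    push_cast
    ring_nf
  have h := hC x
  rw [hfin, hexp1, hexp2] at h
  refine le_trans (le_of_eq ?_) ((Complex.abs_re_le_norm _).trans h)
  rw [Complex.sub_re, Complex.sub_re, hre, Complex.re_ofReal_mul, Complex.re_ofReal_mul]

/-- Substitution `u = x − log n` in the `n`-th integrated term (`n ≥ 1`; both sides vanish at `n = 0`):
`∫_{y'}^{y} e^{-x/2} c(n) n^{-1/2} k(x − log n) dx = (c(n)/n) (∫_{A − log n}^{y − log n} − ∫_{A − log n}^{y' − log n}) e^{-u/2} k(u) du`.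
[folklore] -/
theorem integral_term_eq {k : ℝ → ℝ} (hk : Continuous k) (c : ℕ → ℝ) (n : ℕ) (A y' y : ℝ) :
    ∫ x in y'..y, Real.exp (-(x / 2)) * (c n / Real.sqrt n * k (x - Real.log n)) =
      c n / n * ((∫ u in (A - Real.log n)..(y - Real.log n), Real.exp (-(u / 2)) * k u) -
        ∫ u in (A - Real.log n)..(y' - Real.log n), Real.exp (-(u / 2)) * k u) := by
  rcases Nat.eq_zero_or_pos n with rfl | hn
  · simp
  have hkc : Continuous fun u => Real.exp (-(u / 2)) * k u := by fun_prop
  rw [intervalIntegral.integral_interval_sub_left (hkc.intervalIntegrable _ _) (hkc.intervalIntegrable _ _)]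
  have hn0 : (0 : ℝ) < n := by exact_mod_cast hn
  have hsq : 0 < Real.sqrt n := Real.sqrt_pos.2 hn0
  have hsubst : ∫ x in y'..y, Real.exp (-(x / 2)) * k (x - Real.log n) =
      (Real.sqrt n)⁻¹ * ∫ u in (y' - Real.log n)..(y - Real.log n), Real.exp (-(u / 2)) * k u := by
    rw [← intervalIntegral.integral_const_mul,
      ← intervalIntegral.integral_comp_sub_right
        (fun u => (Real.sqrt n)⁻¹ * (Real.exp (-(u / 2)) * k u)) (Real.log n)]
    refine intervalIntegral.integral_congr fun x _ => ?_
    have he : Real.exp (-((x - Real.log n) / 2)) = Real.sqrt n * Real.exp (-(x / 2)) := by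
      rw [show -((x - Real.log n) / 2) = Real.log n / 2 + -(x / 2) by ring, Real.exp_add,
        ← Real.log_sqrt hn0.le, Real.exp_log hsq]
    simp only [he]
    field_simp
  have hpt : ∀ x : ℝ, Real.exp (-(x / 2)) * (c n / Real.sqrt n * k (x - Real.log n)) =
      c n / Real.sqrt n * (Real.exp (-(x / 2)) * k (x - Real.log n)) := fun x => by ring
  simp_rw [hpt]
  rw [intervalIntegral.integral_const_mul, hsubst, ← mul_assoc, ← div_eq_mul_inv, div_div,
    Real.mul_self_sqrt hn0.le]

/-! ## The integrated discrepancy (auxiliary anchor) -/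

/-- **Integrated discrepancy** (auxiliary anchor `stub_fakeMertens_integrated` of this helper file).
For `2a ≤ y' ≤ y` and `N > e^{y + 2}`, integrating `e^{-x/2} d(x)` (`|d| ≤ C`, `abs_re_discrepancy_le`)
over `[y', y]` and substituting `u = x − log n` termwise (`integral_term_eq`):
`|Φ(y) − Φ(y') − (y − y') Re K̂(0)| ≤ 2C e^{-y'/2} + |Re K̂(1)| e^{-y'}`, where
`Φ(y) = Σ_{n < N} (c(n)/n) ∫_{2a − log n}^{y − log n} e^{-u/2} Re K(u) du`, `K = φ ⋆ φ̃`. [folklore] -/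
theorem stub_fakeMertens_integrated :
    ∀ c : ℕ → ℝ, ∀ φ : ℝ → ℂ, IsWeilTest φ → ∀ a : ℝ, 0 < a → a ≤ 1 → tsupport φ ⊆ Set.Icc (-a) a →
      ∀ C : ℝ, (∀ x : ℝ,
        ‖(∑' n : ℕ, ((c n : ℝ) : ℂ) / (Real.sqrt n : ℂ) *
            (weilConv φ (weilReflect φ) (x + Real.log n) + weilConv φ (weilReflect φ) (x - Real.log n))) -
          Complex.exp (x / 2) * weilMellin (weilConv φ (weilReflect φ)) 0 -
          Complex.exp (-(x / 2)) * weilMellin (weilConv φ (weilReflect φ)) 1‖ ≤ C) →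
      ∀ y' y : ℝ, 2 * a ≤ y' → y' ≤ y → ∀ N : ℕ, Real.exp (y + 2) < N →
        |(∑ n ∈ Finset.range N, c n / n * ∫ u in (2 * a - Real.log n)..(y - Real.log n),
              Real.exp (-(u / 2)) * (weilConv φ (weilReflect φ) u).re) -
            (∑ n ∈ Finset.range N, c n / n * ∫ u in (2 * a - Real.log n)..(y' - Real.log n),
              Real.exp (-(u / 2)) * (weilConv φ (weilReflect φ) u).re) -
            (y - y') * (weilMellin (weilConv φ (weilReflect φ)) 0).re| ≤
          2 * C * Real.exp (-(y' / 2)) +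
            |(weilMellin (weilConv φ (weilReflect φ)) 1).re| * Real.exp (-y') := by
  intro c φ hφ a ha ha1 hsupp C hC y' y hy' hyy N hN
  set K := weilConv φ (weilReflect φ) with hK
  set κ := (weilMellin K 0).re with hκ
  set κ₁ := (weilMellin K 1).re with hκ₁
  have hKc : Continuous K := (hφ.weilConv hφ.weilReflect).1.continuous
  have hKrc : Continuous fun u => (K u).re := Complex.continuous_re.comp hKc
  have hC0 : 0 ≤ C := (norm_nonneg _).trans (hC 0)
  -- the real discrepancy `d` and its bound on `(y', y]`
  set d : ℝ → ℝ := fun x => (∑ n ∈ Finset.range N, c n / Real.sqrt n * (K (x - Real.log n)).re) -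
    Real.exp (x / 2) * κ - Real.exp (-(x / 2)) * κ₁ with hd
  have hd_le : ∀ x ∈ Ioc y' y, |d x| ≤ C := fun x hx =>
    abs_re_discrepancy_le hφ ha ha1 hsupp hC (by linarith [hx.1])
      (lt_of_le_of_lt (Real.exp_le_exp.2 (by linarith [hx.2])) hN)
  -- the two exponential integrals
  have hI1 : ∫ x in y'..y, Real.exp (-(x / 2)) = -2 * Real.exp (-(y / 2)) - -2 * Real.exp (-(y' / 2)) := by
    refine intervalIntegral.integral_eq_sub_of_hasDerivAt (f := fun x => -2 * Real.exp (-(x / 2)))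
      (fun x _ => ?_)
      ((by fun_prop : Continuous fun x : ℝ => Real.exp (-(x / 2))).intervalIntegrable _ _)
    have h := ((hasDerivAt_id x).div_const 2).neg.exp.const_mul (-2)
    refine h.congr_deriv ?_
    simp only [Pi.neg_apply, id_eq]
    ring
  have hI2 : ∫ x in y'..y, Real.exp (-x) = -Real.exp (-y) - -Real.exp (-y') := by
    refine intervalIntegral.integral_eq_sub_of_hasDerivAt (f := fun x => -Real.exp (-x)) (fun x _ => ?_)
      ((by fun_prop : Continuous fun x : ℝ => Real.exp (-x)).intervalIntegrable _ _)
    have h := ((hasDerivAt_id x).neg.exp).neg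
    refine h.congr_deriv ?_
    simp only [Pi.neg_apply, id_eq]
    ring
  -- bound on the integral of `e^{-x/2} d(x)`
  have hbound : |∫ x in y'..y, Real.exp (-(x / 2)) * d x| ≤ 2 * C * Real.exp (-(y' / 2)) := by
    have h1 : ‖∫ x in y'..y, Real.exp (-(x / 2)) * d x‖ ≤ ∫ x in y'..y, C * Real.exp (-(x / 2)) := by
      refine intervalIntegral.norm_integral_le_of_norm_le hyy (Eventually.of_forall fun x hx => ?_)
        ((by fun_prop : Continuous fun x : ℝ => C * Real.exp (-(x / 2))).intervalIntegrable _ _)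
      rw [Real.norm_eq_abs, abs_mul, abs_of_pos (Real.exp_pos _), mul_comm]
      exact mul_le_mul_of_nonneg_right (hd_le x hx) (Real.exp_pos _).le
    rw [intervalIntegral.integral_const_mul, hI1] at h1
    rw [← Real.norm_eq_abs]
    refine h1.trans ?_
    nlinarith [Real.exp_pos (-(y / 2)), Real.exp_pos (-(y' / 2))]
  -- termwise evaluation of the same integral
  have hpt : ∀ x : ℝ, Real.exp (-(x / 2)) * d x =
      (∑ n ∈ Finset.range N, Real.exp (-(x / 2)) * (c n / Real.sqrt n * (K (x - Real.log n)).re)) -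
        κ - κ₁ * Real.exp (-x) := by
    intro x
    have e1 : Real.exp (-(x / 2)) * (Real.exp (x / 2) * κ) = κ := by
      rw [← mul_assoc, ← Real.exp_add, neg_add_cancel, Real.exp_zero, one_mul]
    have e2 : Real.exp (-(x / 2)) * (Real.exp (-(x / 2)) * κ₁) = κ₁ * Real.exp (-x) := by
      rw [← mul_assoc, ← Real.exp_add, show -(x / 2) + -(x / 2) = -x by ring, mul_comm]
    simp only [hd, mul_sub, Finset.mul_sum, e1, e2]
  have hterm : ∀ n ∈ Finset.range N, IntervalIntegrable
      (fun x => Real.exp (-(x / 2)) * (c n / Real.sqrt n * (K (x - Real.log n)).re)) volume y' y :=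
    fun n _ => (by fun_prop : Continuous fun x : ℝ =>
      Real.exp (-(x / 2)) * (c n / Real.sqrt n * (K (x - Real.log n)).re)).intervalIntegrable _ _
  have hi1 : IntervalIntegrable (fun x => ∑ n ∈ Finset.range N,
      Real.exp (-(x / 2)) * (c n / Real.sqrt n * (K (x - Real.log n)).re)) volume y' y :=
    (continuous_finsetSum _ fun n _ => (by fun_prop : Continuous fun x : ℝ =>
      Real.exp (-(x / 2)) * (c n / Real.sqrt n * (K (x - Real.log n)).re))).intervalIntegrable _ _
  have hi2 : IntervalIntegrable (fun _ : ℝ => κ) volume y' y := intervalIntegrable_const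
  have hi3 : IntervalIntegrable (fun x => κ₁ * Real.exp (-x)) volume y' y :=
    ((by fun_prop : Continuous fun x : ℝ => κ₁ * Real.exp (-x))).intervalIntegrable _ _
  have heval : ∫ x in y'..y, Real.exp (-(x / 2)) * d x =
      (∑ n ∈ Finset.range N, c n / n *
          ((∫ u in (2 * a - Real.log n)..(y - Real.log n), Real.exp (-(u / 2)) * (K u).re) -
            ∫ u in (2 * a - Real.log n)..(y' - Real.log n), Real.exp (-(u / 2)) * (K u).re)) -
        (y - y') * κ - κ₁ * (Real.exp (-y') - Real.exp (-y)) := by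
    simp_rw [hpt]
    rw [intervalIntegral.integral_sub (hi1.sub hi2) hi3, intervalIntegral.integral_sub hi1 hi2,
      intervalIntegral.integral_finsetSum hterm, intervalIntegral.integral_const,
      intervalIntegral.integral_const_mul, hI2, smul_eq_mul,
      Finset.sum_congr rfl fun n _ => integral_term_eq hKrc c n (2 * a) y' y]
    ring
  -- assemble
  have hsplit : (∑ n ∈ Finset.range N, c n / n * ∫ u in (2 * a - Real.log n)..(y - Real.log n),
          Real.exp (-(u / 2)) * (K u).re) -
        (∑ n ∈ Finset.range N, c n / n * ∫ u in (2 * a - Real.log n)..(y' - Real.log n),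
          Real.exp (-(u / 2)) * (K u).re) - (y - y') * κ =
      (∫ x in y'..y, Real.exp (-(x / 2)) * d x) + κ₁ * (Real.exp (-y') - Real.exp (-y)) := by
    rw [heval]
    simp only [mul_sub, Finset.sum_sub_distrib]
    ring
  rw [hsplit]
  refine (abs_add_le _ _).trans (add_le_add hbound ?_)
  rw [abs_mul]
  refine mul_le_mul_of_nonneg_left ?_ (abs_nonneg _)
  rw [abs_of_nonneg (sub_nonneg.2 (Real.exp_le_exp.2 (by linarith)))]
  linarith [Real.exp_pos (-y)]

end Summit.RiemannHypothesis.RiemannHypothesis.Theorems.SignConeConeMagnification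

end
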